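import Summits.Ventures.CertifiedManyBodySolver.Theorems.TcThermcert1FreeGasCurrentCovariance
import Summits.Ventures.CertifiedManyBodySolver.Theorems.TcThermcert1FreeGasOneBodyDecay
import HarnessLib

/-!
# Free canonical gas at `β·t = 8` — S1: time reversal at complex two-fugacity

Helper file for route `TcThermcert1` (crux K1′ `ThermalStiffnessCeilingU8b8_le_7o44`, item `stmt-Ventures-24560`), crux idea
`free-canonical-b8-rung` (card `Cruxes/ThermalStiffnessCeilingU8b10_le_1o8/Ideas/free-canonical-b8-rung.md`, sketch
`Cruxes/ThermalStiffnessCeilingU8b10_le_1o8/FreeCanonicalB8Sketch.lean`, stub S1 `stub_fugacityTrace_current_eq_zero`).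

The scheme for the `U = 0` rung of Hypothesis C at the bet's own `(β, n) = (8, 7/8)` projects the canonical `(M, M)` sector out of the
COMPLEX two-fugacity trace `tr(diag(z^{N↑} w^{N↓}) e^{−βH₀} ·)` (tree: `trace_exp_neg_smul_toBlock_eq_torusIntegral`). Step S1 is the
statement that the plain bond current has ZERO weight in every such twisted trace,

  `tr( diag(z^{N↑} w^{N↓}) · e^{−β dΓ(h)} · j_{ab} ) = 0`   for ALL complex `z, w`,

whenever the one-body matrix `h` is symmetric and spin-diagonal (`j_{ab} = Σ_σ (−i c†_{aσ} c_{bσ} + i c†_{bσ} c_{aσ})`). Consequence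
for the scheme: the integrand of the sector covariance `ω(A j) − ω(A) ω(j)` has no `ω(A)·ω(j)` product term at ANY point of the
fugacity torus (no Lebowitz–Percus plateau for the time-reversal-odd current; F1/F6 of the K1′ `Disproof.lean` honoured at the
integrand level).

Proof: `diag(z^{N↑} w^{N↓}) = Σ_{M,N} z^M w^N P_{M,N}` (§1) and, sector by sector, the tree's `trace_current_eq_zero`
(`Theorems/TcThermcert1FreeGasCurrentCovariance`, the canonical pull-through expansion with `A = 1`) along the two intertwined
families `m ↦ P_{m,N}` (spin ↑) and `m ↦ P_{M,m}` (spin ↓) (§2); §3 specialises to the flux-free `t`-torus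
`hubbardTorusTT'Flux L 0 0 0 = dΓ(h₀)` and the line's bond `(X₀−1, y) → (X₀, y)` — this is the sketch's stub S1 with the
line-local `bondCurrent` unfolded.

HONEST LABEL: finite-dimensional algebra at `U = 0`; a step of a RUNG (BC5-type witness for the C8 bet), reach at `U = 8` ZERO;
decides nothing about K1/K1′/`T_c`; superconductivity in the Hubbard model is NOT proved or advanced by this file beyond the rung.
-/

noncomputable section

namespace Summit.Ventures.CertifiedManyBodySolver.Theorems.TcThermcert1.FreeCanonicalB8

open NormedSpace Matrix Finset
open Literature.MathematicalPhysics.QuantumLattice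
open Literature.Probability.LatticeModels (TorusSite torusGraph)
open Summit.Ventures.CertifiedManyBodySolver.Theorems.TcThermcert1.FreeGasCurrentClustering
open scoped Matrix.Norms.L2Operator ComplexOrder

/-! ## §1 The two-fugacity diagonal as a combination of sector projections -/

section Generic

variable {Λ : Type*} [LinearOrder Λ] [Fintype Λ]

/-- `diag(z^{N↑} w^{N↓}) = Σ_{M ≤ |Λ|} Σ_{N ≤ |Λ|} z^M w^N · P_{M,N}`: the complex two-fugacity weight is a finite linear
combination of the spin-sector projections. -/
theorem diagonal_fugacity_eq_sum_spinSectorProj {inst : DecidableEq (Finset (Orb Λ))} (z w : ℂ) :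
    @diagonal _ ℂ inst _ (fun s : Finset (Orb Λ) => z ^ (upPart s).card * w ^ (downPart s).card) =
      ∑ M ∈ Finset.range (Fintype.card Λ + 1), ∑ N ∈ Finset.range (Fintype.card Λ + 1),
        (z ^ M * w ^ N) • (spinSectorProj M N : Matrix (Finset (Orb Λ)) (Finset (Orb Λ)) ℂ) := by
  ext s t
  simp only [Matrix.sum_apply, Matrix.smul_apply, spinSectorProj, diagonal_apply, smul_eq_mul, mul_ite, mul_one, mul_zero]
  by_cases hst : s = t
  · subst hst
    simp only [if_true]
    rw [Finset.sum_eq_single_of_mem (upPart s).card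
      (Finset.mem_range.2 (Nat.lt_succ_of_le (Finset.card_le_univ _)))]
    · rw [Finset.sum_eq_single_of_mem (downPart s).card
        (Finset.mem_range.2 (Nat.lt_succ_of_le (Finset.card_le_univ _)))]
      · rw [if_pos ⟨rfl, rfl⟩]
      · intro N _ hN
        rw [if_neg (fun h => hN h.2.symm)]
    · intro M _ hM
      exact Finset.sum_eq_zero fun N _ => by rw [if_neg (fun h => hM h.1.symm)]
  · simp only [hst, if_false]
    symm
    exact Finset.sum_eq_zero fun M _ => Finset.sum_eq_zero fun N _ => rfl

/-! ## §2 The current has zero weight in every two-fugacity twisted free trace -/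

/-- **Sector by sector**: `tr(P_{M,N} e^{−βdΓ(h)} j_{ab}) = 0` for `h` symmetric and spin-diagonal (tree's `trace_current_eq_zero`
along `m ↦ P_{m,N}` for spin ↑ and `m ↦ P_{M,m}` for spin ↓). -/
theorem trace_spinSectorProj_mul_gibbsWeight_mul_current_eq_zero (h : Matrix (Orb Λ) (Orb Λ) ℂ)
    (hsym : ∀ q k : Orb Λ, h q k = h k q) (hspin : ∀ q k : Orb Λ, (ofLex q).2 ≠ (ofLex k).2 → h q k = 0)
    (β : ℝ) (M N : ℕ) (a b : Λ) :
    (spinSectorProj M N * gibbsWeight β (dGamma h) *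
        (∑ σ : Fin 2, ((-Complex.I) • (creation (orb a σ) * annihilation (orb b σ)) +
          Complex.I • (creation (orb b σ) * annihilation (orb a σ))))).trace = 0 := by
  have zero_up := trace_current_eq_zero h hsym hspin β 0 (fun m => spinSectorProj m N)
    (fun m x => spinSectorProj_mul_annihilation_up m N x) (fun x => annihilation_up_mul_spinSectorProj_zero N x) a b M
  have zero_dn := trace_current_eq_zero h hsym hspin β 1 (fun m => spinSectorProj M m)
    (fun m x => spinSectorProj_mul_annihilation_down M m x) (fun x => annihilation_down_mul_spinSectorProj_zero M x) a b N
  rw [Matrix.mul_sum, Matrix.trace_sum, Fin.sum_univ_two, zero_up, zero_dn, add_zero]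

/-- **S1, generic form.** For `h` symmetric and spin-diagonal and ALL complex `z, w`:
`tr( diag(z^{N↑} w^{N↓}) e^{−βdΓ(h)} j_{ab} ) = 0`, `j_{ab} = Σ_σ (−i c†_{aσ} c_{bσ} + i c†_{bσ} c_{aσ})`.
(The `DecidableEq` instance of the occupation basis is a free implicit `inst`, as in the tree's `trace_diagonal_fugacity_mul`,
so that the statement unifies with any caller's `diagonal` / `gibbsWeight`.) -/
theorem trace_diagonal_fugacity_mul_gibbsWeight_mul_current_eq_zero {inst : DecidableEq (Finset (Orb Λ))}
    (h : Matrix (Orb Λ) (Orb Λ) ℂ) (hsym : ∀ q k : Orb Λ, h q k = h k q)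
    (hspin : ∀ q k : Orb Λ, (ofLex q).2 ≠ (ofLex k).2 → h q k = 0) (β : ℝ) (z w : ℂ) (a b : Λ) :
    (@diagonal _ ℂ inst _ (fun s : Finset (Orb Λ) => z ^ (upPart s).card * w ^ (downPart s).card) *
        gibbsWeight β (dGamma h) *
        (∑ σ : Fin 2, ((-Complex.I) • (creation (orb a σ) * annihilation (orb b σ)) +
          Complex.I • (creation (orb b σ) * annihilation (orb a σ))))).trace = 0 := by
  rw [diagonal_fugacity_eq_sum_spinSectorProj z w]
  simp only [Finset.sum_mul, smul_mul_assoc, Matrix.trace_sum, Matrix.trace_smul]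
  exact Finset.sum_eq_zero fun M _ => Finset.sum_eq_zero fun N _ => by
    rw [smul_eq_zero]
    right
    -- `inst` versus the canonical `DecidableEq` instance inside `gibbsWeight`: a subsingleton, closed by `convert`
    convert trace_spinSectorProj_mul_gibbsWeight_mul_current_eq_zero h hsym hspin β M N a b using 5
    all_goals rfl

end Generic

/-! ## §3 The flux-free `t`-torus and the line's bond current (sketch stub S1, `bondCurrent` unfolded) -/

section Torus

variable (L : ℕ) [NeZero L]

/-- **S1 (`stub_fugacityTrace_current_eq_zero` of `FreeCanonicalB8Sketch`, with the line-local `bondCurrent L X₀ y` unfolded).**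
On the free flux-free torus `hubbardTorusTT'Flux L 0 0 0`, for every real `β`, ALL complex fugacities `z, w` and every bond
`(X₀−1, y) → (X₀, y)`: `tr( diag(z^{N↑} w^{N↓}) · e^{−βH₀} · j_{X₀,y} ) = 0` (free implicit `inst` as in §2; instantiate the
sketch's stub by `exact`/`convert`). -/
theorem fugacityTrace_current_eq_zero {inst : DecidableEq (Finset (Orb (FermionTorus 2 L)))} (β : ℝ) (z w : ℂ) (X₀ y : ZMod L) :
    (@diagonal _ ℂ inst _ (fun s : Finset (Orb (FermionTorus 2 L)) => z ^ (upPart s).card * w ^ (downPart s).card) *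
        gibbsWeight β (hubbardTorusTT'Flux L 0 0 0) *
        (∑ σ : Fin 2,
          ((-Complex.I) • (creation (orb (FermionTorus.ofTorusSite ![X₀, y]) σ) *
              annihilation (orb (FermionTorus.ofTorusSite ![X₀ - 1, y]) σ)) +
            Complex.I • (creation (orb (FermionTorus.ofTorusSite ![X₀ - 1, y]) σ) *
              annihilation (orb (FermionTorus.ofTorusSite ![X₀, y]) σ))))).trace = 0 := by
  have hsym : ∀ q k : Orb (FermionTorus 2 L),
      hubbardOneBody (fermionTorusGraph 2 L) 1 0 q k = hubbardOneBody (fermionTorusGraph 2 L) 1 0 k q := fun q k => by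
    have h := congrFun (congrFun (hubbardOneBody_torus_transpose L) k) q
    rw [transpose_apply] at h
    exact h
  have hspin : ∀ q k : Orb (FermionTorus 2 L), (ofLex q).2 ≠ (ofLex k).2 →
      hubbardOneBody (fermionTorusGraph 2 L) 1 0 q k = 0 :=
    fun q k hqk => by rw [hubbardOneBody_torus_apply, if_neg (fun h => hqk h.2)]
  rw [hubbardTorusTT'Flux_free_eq_dGamma]
  exact trace_diagonal_fugacity_mul_gibbsWeight_mul_current_eq_zero _ hsym hspin β z w _ _

end Torus

end Summit.Ventures.CertifiedManyBodySolver.Theorems.TcThermcert1.FreeCanonicalB8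

end
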